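import Mathlib.Analysis.ODE.PicardLindelof
import Mathlib.Analysis.ODE.ExistUnique
import Summits.AnomalousDissipation.AnomalousDissipation.Theorems.SolenoidalFractalHomogenisationLagrangianCarrierDistortion
import Summits.AnomalousDissipation.AnomalousDissipation.Theorems.SolenoidalFractalHomogenisationPermissibleFractalCarrierWords
import Summits.AnomalousDissipation.AnomalousDissipation.Theorems.SolenoidalFractalHomogenisationLagrangianRenormalisationStepExistsL
import Literature.Analysis.FunctionSpaces.HolderNormTorusProofs
import HarnessLib

/-!
# Eulerian flows of bounded Lipschitz fields: global existence in integral form and their distortion (K1L `stub_tailL`, plan rev 2 brick (ii))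

Helper file for crux K1L `LagrangianRenormalisationStep` (stmt-AnomalousDissipation-24912), registered stub `stub_tailL` (plan evidence #32).
The interval induction for the distortion of the Lagrangian flows conjugates, at each level, the EULERIAN flow `Y_m` of the lattice level
`level m` over a short interval; this file provides that flow for any jointly continuous, globally bounded, spatially `K`-Lipschitz field
`V : ℝ → E → E` on a complete normed space (`exists_displacement_of_lipschitz_bounded`: Mathlib's Picard–Lindelöf on the ball of radius
`L · (T₁ − t₀)`, one initial point at a time, converted to the INTEGRAL form `φ t y = ∫_{t₀}^t V r (y + φ r y) dr` by the fundamental theorem of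
calculus), hence its distortion `‖φ t y₁ − φ t y₂‖ ≤ (e^{K(t−t₀)} − 1)‖y₁ − y₂‖` (`…Distortion.norm_displacement_sub_le`), and the instance for the
lifted lattice levels `lift (D.level m r)`, which are bounded by `k a_m/(2π N_m)` and `3√3 k a_m`-Lipschitz uniformly in time
(`lipschitzWith_lift_level`, `exists_levelFlow`).  No definitions, no named facts, no sorry.  Prover seat `ad-solenoidal-k2r-lowerlaw-p1` g5, 2026-08-28.
-/

set_option linter.dupNamespace false

noncomputable section

namespace Summit.AnomalousDissipation.AnomalousDissipation.Theorems.SolenoidalFractalHomogenisation.LagrangianCarrier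

open Set Filter Topology MeasureTheory intervalIntegral Metric Function
open scoped NNReal

section Generic

variable {E : Type*} [NormedAddCommGroup E] [NormedSpace ℝ E] [CompleteSpace E]

/-- **Global flow of a bounded Lipschitz field, integral form.**  For `V : ℝ → E → E` jointly continuous, `K`-Lipschitz in space and bounded by
`L`, and `t₀ ≤ T₁`, there is a displacement field `φ` with `φ t y = ∫_{t₀}^t V r (y + φ r y) dr` and `t ↦ φ t y` continuous on `[t₀, T₁]` for
every `y` (Picard–Lindelöf on the ball of radius `L (T₁ − t₀)` around each initial point). [folklore] -/
theorem exists_displacement_of_lipschitz_bounded {V : ℝ → E → E} {K L : ℝ≥0}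
    (hK : ∀ t, LipschitzWith K (V t)) (hL : ∀ t x, ‖V t x‖ ≤ L) (hVc : Continuous fun p : ℝ × E => V p.1 p.2)
    {t₀ T₁ : ℝ} (ht : t₀ ≤ T₁) :
    ∃ φ : ℝ → E → E, (∀ y, ContinuousOn (fun t => φ t y) (Icc t₀ T₁)) ∧
      ∀ y, ∀ t ∈ Icc t₀ T₁, φ t y = ∫ r in t₀..t, V r (y + φ r y) := by
  -- Picard–Lindelöf, one initial point at a time
  have hsol : ∀ y : E, ∃ α : ℝ → E, α t₀ = y ∧ ∀ t ∈ Icc t₀ T₁, HasDerivWithinAt α (V t (α t)) (Icc t₀ T₁) t := by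
    intro y
    have ht₀ : t₀ ∈ Icc t₀ T₁ := ⟨le_rfl, ht⟩
    have hPL : IsPicardLindelof V (⟨t₀, ht₀⟩ : Icc t₀ T₁) y (L * (T₁ - t₀).toNNReal) 0 L K :=
      { lipschitzOnWith := fun t _ => (hK t).lipschitzOnWith
        continuousOn := fun x _ => (hVc.comp (continuous_id.prodMk continuous_const)).continuousOn
        norm_le := fun t _ x _ => hL t x
        mul_max_le := by
          have hmax : max (T₁ - t₀) (t₀ - t₀) = T₁ - t₀ := by rw [sub_self, max_eq_left (sub_nonneg.2 ht)]
          rw [hmax]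
          rw [NNReal.coe_mul, NNReal.coe_zero, sub_zero, Real.coe_toNNReal _ (sub_nonneg.2 ht)] }
    exact hPL.exists_eq_forall_mem_Icc_hasDerivWithinAt₀
  choose α hα0 hα using hsol
  refine ⟨fun t y => α y t - y, fun y => ?_, fun y t htI => ?_⟩
  · have hc : ContinuousOn (α y) (Icc t₀ T₁) := fun t htI => (hα y t htI).continuousWithinAt
    exact hc.sub continuousOn_const
  · -- integral form by the fundamental theorem of calculus
    show α y t - y = ∫ r in t₀..t, V r (y + (α y r - y))
    simp_rw [add_sub_cancel]
    have hcont : ContinuousOn (α y) (Icc t₀ T₁) := fun t htI => (hα y t htI).continuousWithinAt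
    have hg : ContinuousOn (fun r => V r (α y r)) (Icc t₀ T₁) :=
      hVc.comp_continuousOn (continuousOn_id.prodMk hcont)
    have hderiv : ∀ r ∈ Ioo t₀ t, HasDerivAt (α y) (V r (α y r)) r := fun r hr =>
      (hα y r ⟨hr.1.le, hr.2.le.trans htI.2⟩).hasDerivAt (Icc_mem_nhds hr.1 (hr.2.trans_le htI.2))
    have hFTC := integral_eq_sub_of_hasDerivAt_of_le htI.1 (hcont.mono (Icc_subset_Icc_right htI.2)) hderiv
      ((hg.mono (Icc_subset_Icc_right htI.2)).intervalIntegrable_of_Icc htI.1)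
    simp only [hα0] at hFTC
    exact hFTC.symm

/-- **Distortion of the global flow**: the displacement of `exists_displacement_of_lipschitz_bounded` is `(e^{K(t−t₀)} − 1)`-Lipschitz in the
initial point. [cite: ArmstrongVicol2025, §5.1 (flow estimates)] -/
theorem exists_displacement_with_distortion {V : ℝ → E → E} {K L : ℝ≥0}
    (hK : ∀ t, LipschitzWith K (V t)) (hL : ∀ t x, ‖V t x‖ ≤ L) (hVc : Continuous fun p : ℝ × E => V p.1 p.2)
    {t₀ T₁ : ℝ} (ht : t₀ ≤ T₁) :
    ∃ φ : ℝ → E → E, (∀ y, ContinuousOn (fun t => φ t y) (Icc t₀ T₁)) ∧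
      (∀ y, ∀ t ∈ Icc t₀ T₁, φ t y = ∫ r in t₀..t, V r (y + φ r y)) ∧
      ∀ t ∈ Icc t₀ T₁, ∀ y₁ y₂ : E, ‖φ t y₁ - φ t y₂‖ ≤ (Real.exp (K * (t - t₀)) - 1) * ‖y₁ - y₂‖ := by
  obtain ⟨φ, hφc, hφ⟩ := exists_displacement_of_lipschitz_bounded hK hL hVc ht
  exact ⟨φ, hφc, hφ, norm_displacement_sub_le (fun t _ => hK t) hVc hφc hφ⟩

end Generic

/-! ## The Eulerian lattice levels -/

section Level

open Literature.Analysis Literature.Analysis.FunctionSpaces Literature.Analysis.FunctionSpaces.Torus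
open Literature.Analysis.FluidPDE Literature.Analysis.FluidPDE.LatticeShear
open Summit.AnomalousDissipation.AnomalousDissipation.Theorems.SolenoidalFractalHomogenisation.PermissibleCarrier
  (level_eq_smul carrier_nsmul_apply lipschitzWith_layerComb norm_level_le abs_trapezoid_le_one)
open Summit.AnomalousDissipation.AnomalousDissipation.Theorems.SolenoidalFractalHomogenisation.LagrangianRenormalisationStep
  (continuous_uncurry_level)

variable {k : ℕ} (D : FractalCarrierData k)

/-- The level field as a layer combination with envelope coefficients `(a_m/N_m)·env_j(a_m t)`. [cite: ArmstrongVicol2025, §3] -/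
theorem level_apply_eq_layerComb (m : ℕ) (t : ℝ) (x : UnitAddTorus (Fin 3)) :
    D.level m t x = ∑ j, (D.a m / (D.N m : ℝ) * LatticeWord.trapezoid ((D.word m).start j) ((D.word m).phase j).τ (D.word m).ramp
      (Int.fract (D.a m * t / (D.word m).period) * (D.word m).period)) • ((D.word m).phase j).layer (D.N m • x) := by
  rw [level_eq_smul, Pi.smul_apply, carrier_nsmul_apply, Finset.smul_sum]
  refine Finset.sum_congr rfl fun j _ => ?_
  rw [smul_smul]

/-- **The lifted level field is `3√3·k·a_m`-Lipschitz, uniformly in time** (`lipschitzWith_layerComb` with `Σ|c_j| ≤ k a_m/N_m`, and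
`proj` is `1`-Lipschitz). [folklore] -/
theorem lipschitzWith_lift_level (m : ℕ) (t : ℝ) :
    LipschitzWith (NNReal.sqrt 3 * (3 * ((k : ℝ≥0) * ⟨D.a m, (D.a_pos m).le⟩))) (lift (D.level m t)) := by
  set c : Fin k → ℝ := fun j => D.a m / (D.N m : ℝ) * LatticeWord.trapezoid ((D.word m).start j) ((D.word m).phase j).τ (D.word m).ramp
      (Int.fract (D.a m * t / (D.word m).period) * (D.word m).period) with hc
  have hfun : D.level m t = fun x => ∑ j, c j • ((D.word m).phase j).layer (D.N m • x) := by
    funext x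
    exact level_apply_eq_layerComb D m t x
  have hN : (0 : ℝ) < D.N m := by exact_mod_cast D.N_pos m
  have ha := D.a_pos m
  have hsum : ∑ j, |c j| ≤ k * (D.a m / D.N m) := by
    calc ∑ j, |c j| ≤ ∑ _j : Fin k, D.a m / (D.N m : ℝ) := by
          refine Finset.sum_le_sum fun j _ => ?_
          rw [hc, abs_mul, abs_of_pos (div_pos ha hN)]
          exact mul_le_of_le_one_right (div_pos ha hN).le (abs_trapezoid_le_one _ _ _ _)
      _ = k * (D.a m / D.N m) := by simp
  have hL := lipschitzWith_layerComb (D.word m) c (D.N m)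
  rw [← hfun] at hL
  have hL' : LipschitzWith (NNReal.sqrt 3 * (3 * ((k : ℝ≥0) * ⟨D.a m, ha.le⟩))) (D.level m t) := by
    refine hL.weaken ?_
    refine mul_le_mul_of_nonneg_left (mul_le_mul_of_nonneg_left ?_ (by norm_num)) (by positivity)
    rw [← NNReal.coe_le_coe]
    push_cast
    rw [Real.coe_toNNReal _ (Finset.sum_nonneg fun j _ => abs_nonneg _)]
    calc (∑ j, |c j|) * (D.N m : ℝ) ≤ k * (D.a m / D.N m) * D.N m := mul_le_mul_of_nonneg_right hsum hN.le
      _ = k * D.a m := by field_simp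
  rw [show lift (D.level m t) = D.level m t ∘ proj from rfl]
  simpa using hL'.comp lipschitzWith_proj

/-- The level field is jointly continuous (lift). [folklore] -/
theorem continuous_lift_level (m : ℕ) : Continuous fun p : ℝ × EuclideanSpace ℝ (Fin 3) => lift (D.level m p.1) p.2 := by
  have e : (fun p : ℝ × EuclideanSpace ℝ (Fin 3) => lift (D.level m p.1) p.2) =
      uncurry (D.level m) ∘ fun p : ℝ × EuclideanSpace ℝ (Fin 3) => (p.1, proj p.2) := by
    funext p
    simp only [Function.comp_apply, Function.uncurry_apply_pair, lift_apply]
  rw [e]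
  exact (continuous_uncurry_level D m).comp (continuous_fst.prodMk (continuous_proj.comp continuous_snd))

/-- **The Eulerian flow of a lattice level on `[t₀, T₁]`** exists in integral form and its displacement is
`(exp(3√3 k a_m (t − t₀)) − 1)`-Lipschitz: the factor `γ_m(τ)` of the distortion recursion (plan rev 2).
[cite: ArmstrongVicol2025, §5.1 (flow estimates on the refresh windows)] -/
theorem exists_levelFlow (m : ℕ) {t₀ T₁ : ℝ} (ht : t₀ ≤ T₁) :
    ∃ φ : ℝ → EuclideanSpace ℝ (Fin 3) → EuclideanSpace ℝ (Fin 3),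
      (∀ y, ContinuousOn (fun t => φ t y) (Icc t₀ T₁)) ∧
      (∀ y, ∀ t ∈ Icc t₀ T₁, φ t y = ∫ r in t₀..t, lift (D.level m r) (y + φ r y)) ∧
      ∀ t ∈ Icc t₀ T₁, ∀ y₁ y₂, ‖φ t y₁ - φ t y₂‖ ≤
        (Real.exp ((NNReal.sqrt 3 * (3 * ((k : ℝ≥0) * ⟨D.a m, (D.a_pos m).le⟩)) : ℝ≥0) * (t - t₀)) - 1) * ‖y₁ - y₂‖ := by
  have hLbound : ∀ (t : ℝ) (y : EuclideanSpace ℝ (Fin 3)), ‖lift (D.level m t) y‖ ≤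
      ((⟨k * D.a m / (2 * Real.pi * D.N m), by have := D.a_pos m; have := D.N_pos m; positivity⟩ : ℝ≥0) : ℝ) := by
    intro t y
    rw [lift_apply]
    exact norm_level_le D m t (proj y)
  exact exists_displacement_with_distortion (V := fun r y => lift (D.level m r) y)
    (fun t => lipschitzWith_lift_level D m t) hLbound (continuous_lift_level D m) ht

end Level

end Summit.AnomalousDissipation.AnomalousDissipation.Theorems.SolenoidalFractalHomogenisation.LagrangianCarrier

end
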